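import Literature.Analysis.FunctionSpaces.TorusMollifierEstimates
import Literature.Analysis.FunctionSpaces.TorusFourierConvolution
import Literature.Analysis.FunctionSpaces.TorusFourierSeries
import HarnessLib

/-!
# Mollified vector fields on `T^d`: the Besov mollification error and a Fourier sup bound

Analysis/FunctionSpaces support file (theorem-only). The two halves of the standard
"low/high frequency" splitting `w = (w - ρ ⋆ w) + ρ ⋆ w` of a vector field `w : T^d → ℝ^d` by a
nonnegative unit-mass kernel `ρ` (here the tree's standard mollifier `Torus.kernel ε`,
`TorusMollifier`; mollification `ρ ⋆ w = ∫ ρ(y) w(· - y) dy`, Mathlib's group convolution with the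
kernel as the *left* factor, so that vector-valued `w` are allowed), as used in compactness
arguments of Aubin–Lions type on the Fourier side (Simon 1987, §8; De Rosa–Isett 2024, §6.1):

* `Torus.eLpNorm_kernel_convolution_sub_self_le` — **high frequencies, CET (6) for vector
  fields**: `‖ρ_ε ⋆ w - w‖_{Lᵖ} ≤ A` whenever `‖w(· - y) - w‖_{Lᵖ} ≤ A` for `‖y‖ ≤ ε`
  (Constantin–E–Titi 1994, (6); the tree's Minkowski–Jensen inequality
  `eLpNorm_integral_smul_le_mul`), and its Besov form
  `Torus.eLpNorm_kernel_convolution_sub_self_le_eBesovSupSeminorm`: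
  `‖ρ_ε ⋆ w - w‖_{Lᵖ} ≤ [w]_{B^s_{p,∞}} ε^s`;
* `Torus.mFourierCoeff_complexify_convolution` — the **convolution theorem for vector fields**,
  `𝓕(ρ ⋆ w)(k) = ρ̂(k) ŵ(k)` (coordinatewise from the tree's scalar
  `Torus.mFourierCoeff_convolution`, Grafakos 2014, Prop. 3.1.2 (9));
* `Torus.norm_kernel_convolution_apply_le` — **low frequencies, a sup bound**: for smooth `w`,
  every `x` and every truncation order `K`,
  `‖(ρ_ε ⋆ w)(x)‖ ≤ ∑_{|k| ≤ K} ‖ŵ(k)‖ + (∫ ‖w‖) · ∑_{|k| > K} |ρ̂_ε(k)|`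
  (pointwise Fourier inversion of the smooth field `ρ_ε ⋆ w`, `|ρ̂_ε| ≤ 1`, `‖ŵ(k)‖ ≤ ‖w‖_{L¹}`),
  the tail `∑_{|k|>K} |ρ̂_ε(k)|` being finite (`Torus.summable_norm_mFourierCoeff_ofReal_of_isSmooth`)
  and independent of `w`.

## Mathlib search

Mathlib (this pin) has group convolution (`MeasureTheory.convolution`, `convolution_lsmul`),
`ContinuousLinearMap.integral_comp_comm`, multiple Fourier series on `UnitAddTorus`
(`mFourierCoeff`, `hasSum_mFourier_series_of_summable`); no convolution theorem for
`mFourierCoeff`, no mollifiers on the torus and no Besov classes (all from the tree: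
`TorusConvolution`, `TorusMollifier(Estimates)`, `TorusFourierConvolution`, `TorusFourierSeries`,
`BesovDifference`).

## References

* P. Constantin, W. E, E. S. Titi, Comm. Math. Phys. 165 (1994), 207–209, (6). [ConstantinETiti1994]
* L. Grafakos, *Classical Fourier Analysis*, 3rd ed. (2014), Prop. 3.1.2 (9), §3.3.1. [Grafakos2014]
* J. Simon, *Compact sets in the space `L^p(0,T;B)`*, Ann. Mat. Pura Appl. (4) 146 (1987), §8. [Simon1986]
* L. De Rosa, P. Isett, Arch. Ration. Mech. Anal. 248 (2024), Paper No. 11, §6.1. [DeRosaIsett2024]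
-/

noncomputable section

open MeasureTheory TopologicalSpace Set Function Filter Metric ContinuousLinearMap UnitAddTorus
open scoped ENNReal NNReal Convolution InnerProductSpace Topology

namespace Literature.Analysis.FunctionSpaces

namespace Torus

variable {d : Type*} [Fintype d]

/-! ## High frequencies: the mollification error of a vector field (CET (6)) -/

section High

variable {F' : Type*} [NormedAddCommGroup F'] [NormedSpace ℝ F'] [CompleteSpace F'] {ε : ℝ}

/-- The mollification error as a kernel average of differences, kernel on the left:
`(ρ_ε ⋆ w)(x) - w(x) = ∫ ρ_ε(y) (w(x - y) - w(x)) dy` (`∫ ρ_ε = 1`). [folklore] -/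
theorem kernel_convolution_sub_self_apply {w : UnitAddTorus d → F'} (hw : Integrable w volume)
    (hε : 0 < ε) (hε' : ε ≤ 1 / 4) (x : UnitAddTorus d) :
    (kernel ε ⋆ w) x - w x = ∫ y, kernel ε y • (w (x - y) - w x) := by
  have hk := continuous_kernel (d := d) hε hε'
  rw [convolution_lsmul]
  simp only [smul_sub]
  have hi : Integrable (fun y => kernel ε y • w (x - y)) volume :=
    integrable_kernel_smul_comp_sub hw hk x
  rw [integral_sub hi ((hk.integrable_unitAddTorus).smul_const _), integral_smul_const,
    integral_kernel hε hε', one_smul]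

/-- **CET (6) for vector fields.** If `‖w(· - y) - w‖_{Lᵖ} ≤ A` for all `‖y‖ ≤ ε`, then
`‖ρ_ε ⋆ w - w‖_{Lᵖ} ≤ A` (`1 ≤ p < ∞`, `0 < ε ≤ 1/4`, `ρ_ε = Torus.kernel ε`;
Constantin–E–Titi 1994, (6), with the Besov bound replaced by the translation modulus; the
tree's `Torus.eLpNorm_convolution_kernel_sub_self_le` is the scalar case). [cite: ConstantinETiti1994, (6)] -/
theorem eLpNorm_kernel_convolution_sub_self_le {w : UnitAddTorus d → F'} (hw : Integrable w volume)
    (hε : 0 < ε) (hε' : ε ≤ 1 / 4) {p : ℝ≥0∞} (hp : 1 ≤ p) (hp' : p ≠ ⊤) {A : ℝ≥0∞}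
    (hA : ∀ y : UnitAddTorus d, ‖y‖ ≤ ε → eLpNorm (fun x => w (x - y) - w x) p volume ≤ A) :
    eLpNorm (fun x => (kernel ε ⋆ w) x - w x) p volume ≤ A := by
  have hfun : (fun x => (kernel ε ⋆ w) x - w x) = fun x => ∫ y, kernel ε y • (w (x - y) - w x) :=
    funext fun x => kernel_convolution_sub_self_apply hw hε hε' x
  rw [hfun]
  refine (eLpNorm_integral_smul_le_mul (continuous_kernel hε hε').aestronglyMeasurable
    (aestronglyMeasurable_comp_sub_sub hw.aestronglyMeasurable) hp hp'
    (Eventually.of_forall fun y hy => hA y ?_)).trans ?_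
  · exact (mem_ball_zero_iff.1 (support_kernel_subset hε hy)).le
  · rw [lintegral_enorm_kernel hε hε', one_mul]

/-- **The mollification error in a Besov class**: for `0 < s`, `1 ≤ p < ∞`, `0 < ε ≤ 1/4`,
`‖ρ_ε ⋆ w - w‖_{Lᵖ} ≤ [w]_{B^s_{p,∞}} ε^s` (Constantin–E–Titi 1994, (6):
"`‖u^ε - u‖_{L³} ≤ C ε^α ‖u‖_{B^α_{3,∞}}`", here on `T^d` with constant one and for vector
fields). [cite: ConstantinETiti1994, (6)] -/
theorem eLpNorm_kernel_convolution_sub_self_le_eBesovSupSeminorm {w : UnitAddTorus d → F'}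
    (hw : Integrable w volume) (hε : 0 < ε) (hε' : ε ≤ 1 / 4) {p : ℝ≥0∞} (hp : 1 ≤ p)
    (hp' : p ≠ ⊤) {s : ℝ} (hs : 0 < s) :
    eLpNorm (fun x => (kernel ε ⋆ w) x - w x) p volume ≤
      eBesovSupSeminorm s p w volume * ENNReal.ofReal (ε ^ s) :=
  eLpNorm_kernel_convolution_sub_self_le hw hε hε' hp hp'
    fun _ hy => eLpNorm_comp_sub_sub_le_eBesovSupSeminorm hs hy

end High

/-! ## Fourier coefficients: elementary bounds and the convolution theorem for vector fields -/

section Coefficients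

/-- `‖ŵ(k)‖ ≤ ∫ ‖w‖` for an integrable real vector field, `ŵ = 𝓕(complexify ∘ w)`
(`|e_{-k}| ≤ 1`; the scalar form is the tree's `FluidPDE.Torus.norm_mFourierCoeff_le_integral_norm`,
not importable here by layering). [folklore] -/
theorem norm_mFourierCoeff_complexify_le_integral_norm {w : UnitAddTorus d → EuclideanSpace ℝ d}
    (hw : Integrable w volume) (k : d → ℤ) :
    ‖mFourierCoeff (EuclideanSpace.complexify ∘ w) k‖ ≤ ∫ x, ‖w x‖ := by
  have hi : Integrable (EuclideanSpace.complexify ∘ w) volume :=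
    EuclideanSpace.complexify.toContinuousLinearMap.integrable_comp hw
  rw [mFourierCoeff_eq_integral_volume]
  have h1 : ∀ x, ‖mFourier (-k) x • (EuclideanSpace.complexify ∘ w) x‖ ≤ ‖w x‖ := fun x => by
    rw [norm_smul, Function.comp_apply, EuclideanSpace.norm_complexify]
    exact mul_le_of_le_one_left (norm_nonneg _)
      (((mFourier (-k)).norm_coe_le_norm x).trans_eq mFourier_norm)
  exact (norm_integral_le_integral_norm _).trans
    (integral_mono_of_nonneg (ae_of_all _ fun x => norm_nonneg _) hw.norm (ae_of_all _ h1))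

/-- The Fourier coefficients of a nonnegative unit-mass continuous kernel have modulus at most
one: `|ρ̂(k)| ≤ ∫ ρ = 1`. [folklore] -/
theorem norm_mFourierCoeff_ofReal_le_one {ρ : UnitAddTorus d → ℝ} (hρc : Continuous ρ)
    (hρ0 : ∀ y, 0 ≤ ρ y) (hρ1 : ∫ y, ρ y = 1) (k : d → ℤ) :
    ‖mFourierCoeff (fun y => (ρ y : ℂ)) k‖ ≤ 1 := by
  rw [mFourierCoeff_eq_integral_volume]
  have h1 : ∀ x, ‖mFourier (-k) x • (ρ x : ℂ)‖ ≤ ρ x := fun x => by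
    rw [norm_smul, Complex.norm_real, Real.norm_eq_abs, abs_of_nonneg (hρ0 x)]
    exact mul_le_of_le_one_left (hρ0 x)
      (((mFourier (-k)).norm_coe_le_norm x).trans_eq mFourier_norm)
  calc ‖∫ x, mFourier (-k) x • (ρ x : ℂ)‖ ≤ ∫ x, ‖mFourier (-k) x • (ρ x : ℂ)‖ :=
        norm_integral_le_integral_norm _
    _ ≤ ∫ x, ρ x := integral_mono_of_nonneg (ae_of_all _ fun x => norm_nonneg _)
        hρc.integrable_unitAddTorus (ae_of_all _ h1)
    _ = 1 := hρ1

/-- **The Fourier coefficients of a smooth real scalar function are absolutely summable**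
(Grafakos 2014, §3.3.1; deduced from the tree's vector-field version
`Torus.summable_norm_mFourierCoeff_of_isSmooth` by embedding `ρ` as a coordinate of a smooth
vector field; on the zero-dimensional torus the frequency lattice is a single point). [cite: Grafakos2014, Prop. 3.2.6 (8)] -/
theorem summable_norm_mFourierCoeff_ofReal_of_isSmooth {ρ : UnitAddTorus d → ℝ} (hρ : IsSmooth ρ) :
    Summable (fun k : d → ℤ => ‖mFourierCoeff (fun y => (ρ y : ℂ)) k‖) := by
  classical
  rcases isEmpty_or_nonempty d with hd | ⟨⟨i₀⟩⟩
  · exact Summable.of_finite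
  set a : UnitAddTorus d → EuclideanSpace ℝ d := fun x => ρ x • EuclideanSpace.single i₀ (1 : ℝ)
    with ha_def
  have ha : IsSmooth a := hρ.smul' (isSmooth_const _)
  have hcoord : ∀ k, mFourierCoeff (fun y => (ρ y : ℂ)) k =
      mFourierCoeff (EuclideanSpace.complexify ∘ a) k i₀ := by
    intro k
    rw [mFourierCoeff_complexify_apply ha.integrable k i₀]
    congr 1
    funext y
    simp [ha_def]
  refine Summable.of_nonneg_of_le (fun k => norm_nonneg _) (fun k => ?_)
    (summable_norm_mFourierCoeff_of_isSmooth ha)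
  rw [hcoord k]
  exact PiLp.norm_apply_le _ i₀

variable {ρ : UnitAddTorus d → ℝ} {w : UnitAddTorus d → EuclideanSpace ℝ d}

/-- Coordinates of a mollified vector field are the mollified coordinates:
`((ρ ⋆ w)(x))ᵢ = (ρ ⋆ wᵢ)(x)` (the coordinate map is a continuous linear map). [folklore] -/
theorem convolution_apply_coord (hρ : Continuous ρ) (hw : Continuous w) (x : UnitAddTorus d) (i : d) :
    (ρ ⋆ w) x i = (ρ ⋆ fun y => w y i) x := by
  rw [convolution_lsmul, convolution_lsmul]
  have hint : Integrable (fun t => ρ t • w (x - t)) volume :=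
    (hρ.smul (hw.comp (continuous_const.sub continuous_id))).integrable_unitAddTorus
  have h := ((EuclideanSpace.proj i : EuclideanSpace ℝ d →L[ℝ] ℝ).integral_comp_comm hint).symm
  simp only [PiLp.proj_apply] at h
  rw [show (∫ t, ρ t • w (x - t)) i = (∫ t, ρ t • w (x - t)).ofLp i from rfl, h]
  rfl

/-- **Convolution theorem for real vector fields on `T^d`**: for a continuous real kernel `ρ`
and a continuous field `w`, `𝓕(ρ ⋆ w)(k) = ρ̂(k) ŵ(k)` with `ρ̂ = 𝓕(ρ : ℂ)`,
`ŵ = 𝓕(complexify ∘ w)` (Grafakos 2014, Prop. 3.1.2 (9), coordinatewise through the tree's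
scalar `Torus.mFourierCoeff_convolution`). [cite: Grafakos2014, Prop. 3.1.2 (9)] -/
theorem mFourierCoeff_complexify_convolution (hρ : Continuous ρ) (hw : Continuous w) (k : d → ℤ) :
    mFourierCoeff (EuclideanSpace.complexify ∘ (ρ ⋆ w)) k =
      mFourierCoeff (fun y => (ρ y : ℂ)) k • mFourierCoeff (EuclideanSpace.complexify ∘ w) k := by
  have hcw : Continuous (ρ ⋆ w) := continuous_convolution hρ.integrable_unitAddTorus hw
  ext i
  rw [PiLp.smul_apply, smul_eq_mul, mFourierCoeff_complexify_apply hcw.integrable_unitAddTorus k i,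
    mFourierCoeff_complexify_apply hw.integrable_unitAddTorus k i]
  have hfun : (fun x => ((ρ ⋆ w) x i : ℂ)) = ρ ⋆ fun y => ((w y i : ℝ) : ℂ) := by
    funext x
    rw [convolution_apply_coord hρ hw x i, ofReal_convolution]
  have hwi : Continuous fun y => w y i := (EuclideanSpace.proj i).continuous.comp hw
  rw [hfun]
  exact mFourierCoeff_convolution hρ (Complex.continuous_ofReal.comp hwi) k

end Coefficients

/-! ## Low frequencies: a Fourier sup bound for mollified smooth fields -/

section Low

variable [DecidableEq d] {ε : ℝ}

/-- **Sup bound for a mollified smooth field through its Fourier coefficients.** For a smooth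
real vector field `w` on `T^d`, the standard mollifier `ρ_ε = Torus.kernel ε` (`0 < ε ≤ 1/4`),
every truncation order `K` and every point `x`,
`‖(ρ_ε ⋆ w)(x)‖ ≤ ∑_{|k| ≤ K} ‖ŵ(k)‖ + (∫ ‖w‖) · ∑_{|k| > K} |ρ̂_ε(k)|`:
split `ρ_ε ⋆ w = P_K(ρ_ε ⋆ w) + (ρ_ε ⋆ w - P_K(ρ_ε ⋆ w))`, bound the truncation by the sum of
its coefficients `ρ̂_ε(k) ŵ(k)` with `|ρ̂_ε| ≤ 1`, and the remainder by the absolutely convergent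
tail (`Torus.norm_sub_fourierTruncate_apply_le`) with `‖ŵ(k)‖ ≤ ‖w‖_{L¹}`. The low modes are
controlled by finitely many Fourier coefficients of `w`, the high ones uniformly by `‖w‖_{L¹}`
(the finite-dimensional-projection step of Aubin–Lions type arguments, Simon 1987, §8). [folklore] -/
theorem norm_kernel_convolution_apply_le {w : UnitAddTorus d → EuclideanSpace ℝ d} (hw : IsSmooth w)
    (hε : 0 < ε) (hε' : ε ≤ 1 / 4) (K : ℕ) (x : UnitAddTorus d) :
    ‖(kernel ε ⋆ w) x‖ ≤
      ∑ k ∈ freqBall K, ‖mFourierCoeff (EuclideanSpace.complexify ∘ w) k‖ +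
        (∫ y, ‖w y‖) * ∑' k : {k // k ∉ freqBall (d := d) K},
          ‖mFourierCoeff (fun y => (kernel ε y : ℂ)) (k : d → ℤ)‖ := by
  have hρs : IsSmooth (kernel (d := d) ε) := isSmooth_kernel hε hε'
  have hρc : Continuous (kernel (d := d) ε) := hρs.continuous
  set a : UnitAddTorus d → EuclideanSpace ℝ d := kernel ε ⋆ w with ha_def
  have ha : IsSmooth a := isSmooth_convolution hρc.integrable_unitAddTorus hw
  have hcoef : ∀ k, mFourierCoeff (EuclideanSpace.complexify ∘ a) k =
      mFourierCoeff (fun y => (kernel ε y : ℂ)) k • mFourierCoeff (EuclideanSpace.complexify ∘ w) k :=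
    fun k => mFourierCoeff_complexify_convolution hρc hw.continuous k
  have hone : ∀ k, ‖mFourierCoeff (fun y => (kernel ε y : ℂ)) k‖ ≤ 1 := fun k =>
    norm_mFourierCoeff_ofReal_le_one hρc (kernel_nonneg hε.le) (integral_kernel hε hε') k
  have hw1 : ∀ k, ‖mFourierCoeff (EuclideanSpace.complexify ∘ w) k‖ ≤ ∫ y, ‖w y‖ := fun k =>
    norm_mFourierCoeff_complexify_le_integral_norm hw.integrable k
  -- the truncation
  have h1 : ‖fourierTruncate K a x‖ ≤ ∑ k ∈ freqBall K, ‖mFourierCoeff (EuclideanSpace.complexify ∘ w) k‖ := by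
    rw [fourierTruncate_eq]
    refine (norm_realTrigPoly_apply_le _ _ x).trans (Finset.sum_le_sum fun k _ => ?_)
    rw [hcoef k, norm_smul]
    exact mul_le_of_le_one_left (norm_nonneg _) (hone k)
  -- the remainder
  have h2 : ‖a x - fourierTruncate K a x‖ ≤ (∫ y, ‖w y‖) *
      ∑' k : {k // k ∉ freqBall (d := d) K}, ‖mFourierCoeff (fun y => (kernel ε y : ℂ)) (k : d → ℤ)‖ := by
    refine (norm_sub_fourierTruncate_apply_le ha K x).trans ?_
    rw [← tsum_mul_left]
    refine Summable.tsum_le_tsum (fun k => ?_) ((summable_norm_mFourierCoeff_of_isSmooth ha).subtype _)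
      (((summable_norm_mFourierCoeff_ofReal_of_isSmooth hρs).mul_left _).subtype _)
    rw [hcoef k, norm_smul, mul_comm]
    exact mul_le_mul_of_nonneg_right (hw1 k) (norm_nonneg _)
  calc ‖a x‖ = ‖fourierTruncate K a x + (a x - fourierTruncate K a x)‖ := by
        congr 1
        abel
    _ ≤ ‖fourierTruncate K a x‖ + ‖a x - fourierTruncate K a x‖ := norm_add_le _ _
    _ ≤ _ := add_le_add h1 h2

omit [DecidableEq d] in
/-- The Fourier tail of the mollifier vanishes: `∑_{|k| > K} |ρ̂_ε(k)| → 0` as `K → ∞` (tails of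
a series over growing balls, Mathlib's `tendsto_tsum_compl_atTop_zero`; for `0 < ε ≤ 1/4` the
series converges absolutely by `Torus.summable_norm_mFourierCoeff_ofReal_of_isSmooth`). [folklore] -/
theorem tendsto_tsum_compl_norm_mFourierCoeff_kernel [DecidableEq d] (ε : ℝ) :
    Tendsto (fun K : ℕ => ∑' k : {k // k ∉ freqBall (d := d) K},
      ‖mFourierCoeff (fun y => (kernel ε y : ℂ)) (k : d → ℤ)‖) atTop (𝓝 0) :=
  (tendsto_tsum_compl_atTop_zero fun k : d → ℤ =>
    ‖mFourierCoeff (fun y => (kernel ε y : ℂ)) k‖).comp tendsto_freqBall_atTop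

end Low

end Torus

end Literature.Analysis.FunctionSpaces

end
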